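import Literature.Geometry.DiscreteGeometry.TwoShellPatterns
import Literature.MathematicalPhysics.StatisticalMechanics.LennardJonesClusters

/-!
# The collinear comb — witness configuration for the negative knowledge on crux
# `NearFieldConvexity` (stmt-AtomisticToContinuum-13958; standing disprover, gen 1)

`comb M : Fin (M + 18 + 1) → ℝ³`: the perfect fcc two-shell cluster `{0} ∪ fccTwoShellPattern`
(`19` points: centre `0`, pattern norms `1` and `√2`, pattern `1`-separated — all from
`Literature.Geometry.DiscreteGeometry.TwoShellPatterns`) together with `M` FAR particles
`(2 + k/(2M))·e₀`, `k < M`, on the segment `[2, 5/2)·e₀`.  Proved here: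

* `comb_separated` — the comb is `1/(2M)`-separated (`M ≥ 1`);
* `good_centre` — its centre is `1/20`-good on the window `[47/50, 1]` (indeed `0`-good at scale
  `a = 1`: the `3/2`-neighbourhood of `0` is exactly the fcc two-shell pattern, the far particles
  being at distance `≥ 2`);
* `one_le_norm_combPos` — every other particle is at distance `≥ 1` from the centre;
* `siteEnergy_centre_le` — the centre's Lennard-Jones site energy is `≤ −M/2000`
  (`lennardJones_le_on_annulus`: `V_LJ ≤ −1/2000` on `[2, 5/2]`; the tree's
  `lennardJones_nonpos`: `V_LJ ≤ 0` on `[1, ∞)`).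

So one good particle can sit next to `δ`-separated matter (`δ = 1/(2M)`) that drives its site
energy to `−∞` as `M → ∞` without touching its goodness: the mechanism behind
`Negative/LoadBearing.lean` (separation, `δ`-dependence of `C`, the boundary charge and the collar
radius of `NearFieldConvexity` are all load-bearing).  Supports item stmt-AtomisticToContinuum-13958;
workfile `Cruxes/NearFieldConvexity/Disproof.lean`.
-/

noncomputable section

open scoped BigOperators
open Literature.MathematicalPhysics.StatisticalMechanics Literature.Geometry.DiscreteGeometry

namespace Summit.AtomisticToContinuum.Crystallization.Theorems.NearFieldConvexity.Negative.Comb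

local notation "E3" => EuclideanSpace ℝ (Fin 3)

/-! ## Scalar facts -/

/-- `V_LJ ≤ −1/2000` on the comb annulus `[2, 5/2]`
(`r⁻¹² ≤ 2⁻¹²`, `r⁻⁶ ≥ (2/5)⁶`). [cite: BlancLewin2015, §1.1 (3)] -/
theorem lennardJones_le_on_annulus {r : ℝ} (h1 : 2 ≤ r) (h2 : r ≤ 5 / 2) :
    lennardJones r ≤ -(1 / 2000) := by
  unfold lennardJones
  have hr : 0 < r := by linarith
  have h0 : 0 ≤ r⁻¹ := inv_nonneg.2 hr.le
  have ha : r⁻¹ ≤ 1 / 2 := by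
    rw [inv_eq_one_div]
    exact one_div_le_one_div_of_le (by norm_num) h1
  have hb : 2 / 5 ≤ r⁻¹ := by
    rw [inv_eq_one_div, div_le_div_iff₀ (by norm_num) hr]
    linarith
  have h12 : r⁻¹ ^ 12 ≤ (1 / 2) ^ 12 := pow_le_pow_left₀ h0 ha 12
  have h6 : (2 / 5 : ℝ) ^ 6 ≤ r⁻¹ ^ 6 := pow_le_pow_left₀ (by norm_num) hb 6
  norm_num at h12 h6 ⊢
  linarith

/-! ## The comb witness -/

/-- `δ`-separation of a finite configuration (the crux's hypothesis, verbatim). -/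
def Separated {N : ℕ} (δ : ℝ) (x : Fin N → E3) : Prop :=
  ∀ i j : Fin N, i ≠ j → δ ≤ dist (x i) (x j)

/-- Decoding of the index type `Fin (M + 18 + 1)`: `M` far particles, `18` pattern points, the centre. -/
def combIdx (M : ℕ) : Fin (M + 18 + 1) ≃ (Fin M ⊕ Fin 18) ⊕ Fin 1 :=
  finSumFinEquiv.symm.trans (Equiv.sumCongr finSumFinEquiv.symm (Equiv.refl (Fin 1)))

/-- An enumeration of the fcc two-shell pattern (`18` points). -/
def patEnum : Fin 18 ≃ {v : E3 // v ∈ fccTwoShellPattern} :=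
  (Finset.equivFinOfCardEq card_fccTwoShellPattern).symm

/-- The far particles of the comb: `(2 + k/(2M))·e₀`, `k < M`. -/
def combFar (M : ℕ) (k : Fin M) : E3 :=
  (2 + (k : ℝ) / (2 * M)) • EuclideanSpace.single (0 : Fin 3) (1 : ℝ)

/-- Positions of the comb by decoded index. -/
def combPos (M : ℕ) : (Fin M ⊕ Fin 18) ⊕ Fin 1 → E3
  | Sum.inl (Sum.inl k) => combFar M k
  | Sum.inl (Sum.inr q) => (patEnum q : E3)
  | Sum.inr _ => 0

/-- **The collinear comb**: centre `0`, the `18` fcc two-shell pattern points, and `M` far particles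
on `[2, 5/2)·e₀`. -/
def comb (M : ℕ) : Fin (M + 18 + 1) → E3 := fun n => combPos M (combIdx M n)

/-- The index of the centre. -/
def centre (M : ℕ) : Fin (M + 18 + 1) := (combIdx M).symm (Sum.inr 0)

/-- Positions by decoded index. [folklore] -/
theorem comb_symm_apply (M : ℕ) (u : (Fin M ⊕ Fin 18) ⊕ Fin 1) :
    comb M ((combIdx M).symm u) = combPos M u := by
  simp [comb]

/-- The centre sits at the origin. [folklore] -/
theorem comb_centre (M : ℕ) : comb M (centre M) = 0 := by
  rw [centre, comb_symm_apply]; rfl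

/-- `‖(2 + k/(2M))·e₀‖ = 2 + k/(2M)`. [folklore] -/
theorem norm_combFar (M : ℕ) (k : Fin M) : ‖combFar M k‖ = 2 + (k : ℝ) / (2 * M) := by
  have h : (0 : ℝ) ≤ 2 + (k : ℝ) / (2 * M) := by positivity
  rw [combFar, norm_smul, Real.norm_of_nonneg h]
  simp

/-- Far particles are at distance `≥ 2` from the centre. [folklore] -/
theorem two_le_norm_combFar (M : ℕ) (k : Fin M) : 2 ≤ ‖combFar M k‖ := by
  rw [norm_combFar]
  have : (0 : ℝ) ≤ (k : ℝ) / (2 * M) := by positivity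
  linarith

/-- Far particles are at distance `≤ 5/2` from the centre. [folklore] -/
theorem norm_combFar_le {M : ℕ} (k : Fin M) : ‖combFar M k‖ ≤ 5 / 2 := by
  rw [norm_combFar]
  have hM : (0 : ℝ) < M := by
    have : 0 < M := lt_of_le_of_lt (Nat.zero_le _) k.2
    exact_mod_cast this
  have hk : (k : ℝ) < M := by exact_mod_cast k.2
  have : (k : ℝ) / (2 * M) ≤ 1 / 2 := by
    rw [div_le_iff₀ (by positivity)]
    linarith
  linarith

/-- Mutual distances of the far particles: `|k − k'|/(2M)`. [folklore] -/
theorem dist_combFar (M : ℕ) (k k' : Fin M) :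
    dist (combFar M k) (combFar M k') = |(k : ℝ) - k'| / (2 * M) := by
  have hM : (0 : ℝ) < M := by
    have : 0 < M := lt_of_le_of_lt (Nat.zero_le _) k.2
    exact_mod_cast this
  rw [combFar, combFar, dist_eq_norm, ← sub_smul, norm_smul]
  have e : (2 + (k : ℝ) / (2 * M)) - (2 + (k' : ℝ) / (2 * M)) = ((k : ℝ) - k') / (2 * M) := by ring
  rw [e, Real.norm_eq_abs, abs_div, abs_of_pos (by positivity : (0 : ℝ) < 2 * M)]
  simp

/-- Pattern points have norm `≥ 1`. [cite: HalesDSP2012, §1.3] -/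
theorem one_le_norm_pat (q : Fin 18) : 1 ≤ ‖((patEnum q : {v : E3 // v ∈ fccTwoShellPattern}) : E3)‖ := by
  rcases norm_of_mem_fccTwoShellPattern (patEnum q).2 with h | h
  · rw [h]
  · rw [h]
    exact Real.one_le_sqrt.2 (by norm_num)

/-- Pattern points have norm `≤ √2`. [cite: HalesDSP2012, §1.3] -/
theorem norm_pat_le (q : Fin 18) : ‖((patEnum q : {v : E3 // v ∈ fccTwoShellPattern}) : E3)‖ ≤ Real.sqrt 2 :=
  norm_le_sqrt_two_of_mem_twoShellPattern (Or.inl rfl) (patEnum q).2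

/-- Every particle of the comb other than the centre is at distance `≥ 1` from the centre. -/
theorem one_le_norm_combPos (M : ℕ) {u : (Fin M ⊕ Fin 18) ⊕ Fin 1} (hu : u ≠ Sum.inr 0) :
    1 ≤ ‖combPos M u‖ := by
  rcases u with ((k | q) | o)
  · exact le_trans (by norm_num) (two_le_norm_combFar M k)
  · exact one_le_norm_pat q
  · exact absurd (by rw [Subsingleton.elim o 0]) hu

/-- Pairwise distances of the comb by decoded indices: `≥ 1/(2M)`. -/
theorem combPos_separated {M : ℕ} (hM : 1 ≤ M) {u u' : (Fin M ⊕ Fin 18) ⊕ Fin 1} (hne : u ≠ u') :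
    1 / (2 * (M : ℝ)) ≤ dist (combPos M u) (combPos M u') := by
  have hM' : (1 : ℝ) ≤ M := by exact_mod_cast hM
  have hhalf : 1 / (2 * (M : ℝ)) ≤ 1 / 2 :=
    one_div_le_one_div_of_le (by norm_num) (by linarith : (2 : ℝ) ≤ 2 * M)
  have hs : Real.sqrt 2 < 3 / 2 := by
    rw [Real.sqrt_lt' (by norm_num)]; norm_num
  -- the three mixed lower bounds
  have far_pat : ∀ (k : Fin M) (q : Fin 18),
      1 / (2 * (M : ℝ)) ≤ dist (combFar M k) ((patEnum q : {v : E3 // v ∈ fccTwoShellPattern}) : E3) := by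
    intro k q
    rw [dist_eq_norm]
    have h1 := norm_sub_norm_le (combFar M k) ((patEnum q : {v : E3 // v ∈ fccTwoShellPattern}) : E3)
    have h2 := two_le_norm_combFar M k
    have h3 := norm_pat_le q
    linarith
  have far_cen : ∀ k : Fin M, 1 / (2 * (M : ℝ)) ≤ dist (combFar M k) 0 := by
    intro k
    rw [dist_zero_right]
    linarith [two_le_norm_combFar M k]
  have pat_cen : ∀ q : Fin 18,
      1 / (2 * (M : ℝ)) ≤ dist ((patEnum q : {v : E3 // v ∈ fccTwoShellPattern}) : E3) 0 := by
    intro q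
    rw [dist_zero_right]
    linarith [one_le_norm_pat q]
  rcases u with ((k | q) | o) <;> rcases u' with ((k' | q') | o')
  · -- far / far
    show 1 / (2 * (M : ℝ)) ≤ dist (combFar M k) (combFar M k')
    have hkk : k ≠ k' := fun h => hne (by rw [h])
    have hk : (k : ℕ) ≠ k' := fun h => hkk (Fin.ext h)
    have h1 : (1 : ℝ) ≤ |((k : ℕ) : ℝ) - ((k' : ℕ) : ℝ)| := by
      rcases Nat.lt_or_gt_of_ne hk with h | h
      · have : (k : ℝ) + 1 ≤ k' := by exact_mod_cast h
        rw [abs_sub_comm, abs_of_nonneg (by linarith)]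
        linarith
      · have : (k' : ℝ) + 1 ≤ k := by exact_mod_cast h
        rw [abs_of_nonneg (by linarith)]
        linarith
    rw [dist_combFar]
    exact div_le_div_of_nonneg_right h1 (by positivity)
  · exact far_pat k q'
  · show 1 / (2 * (M : ℝ)) ≤ dist (combFar M k) 0
    exact far_cen k
  · show 1 / (2 * (M : ℝ)) ≤ dist ((patEnum q : {v : E3 // v ∈ fccTwoShellPattern}) : E3) (combFar M k')
    rw [dist_comm]; exact far_pat k' q
  · -- pattern / pattern
    show 1 / (2 * (M : ℝ)) ≤ dist ((patEnum q : {v : E3 // v ∈ fccTwoShellPattern}) : E3)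
      ((patEnum q' : {v : E3 // v ∈ fccTwoShellPattern}) : E3)
    have hqq : q ≠ q' := fun h => hne (by rw [h])
    have hvw : ((patEnum q : {v : E3 // v ∈ fccTwoShellPattern}) : E3) ≠
        ((patEnum q' : {v : E3 // v ∈ fccTwoShellPattern}) : E3) := fun h =>
      hqq (patEnum.injective (Subtype.ext h))
    have h1 := one_le_dist_of_mem_fccTwoShellPattern (patEnum q).2 (patEnum q').2 hvw
    linarith
  · show 1 / (2 * (M : ℝ)) ≤ dist ((patEnum q : {v : E3 // v ∈ fccTwoShellPattern}) : E3) 0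
    exact pat_cen q
  · show 1 / (2 * (M : ℝ)) ≤ dist (0 : E3) (combFar M k')
    rw [dist_comm]; exact far_cen k'
  · show 1 / (2 * (M : ℝ)) ≤ dist (0 : E3) ((patEnum q' : {v : E3 // v ∈ fccTwoShellPattern}) : E3)
    rw [dist_comm]; exact pat_cen q'
  · exact absurd (by rw [Subsingleton.elim o o']) hne

/-- **The comb is `1/(2M)`-separated.** -/
theorem comb_separated {M : ℕ} (hM : 1 ≤ M) : Separated (1 / (2 * (M : ℝ))) (comb M) := by
  intro i j hij
  obtain ⟨u, rfl⟩ := (combIdx M).symm.surjective i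
  obtain ⟨u', rfl⟩ := (combIdx M).symm.surjective j
  have hne : u ≠ u' := fun h => hij (by rw [h])
  rw [comb_symm_apply, comb_symm_apply]
  exact combPos_separated hM hne

/-- **The centre of the comb is `1/20`-good** (indeed `0`-good at scale `a = 1`: its
`3/2`-neighbourhood is exactly the fcc two-shell pattern, the far particles being at distance
`≥ 2`). -/
theorem good_centre (M : ℕ) : IsTwoShellGood (1 / 20) (47 / 50) 1 (comb M) (centre M) := by
  classical
  refine ⟨1, by norm_num, le_rfl, LinearIsometry.id, fccTwoShellPattern,
    fun v => if h : v ∈ fccTwoShellPattern then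
      (combIdx M).symm (Sum.inl (Sum.inr (patEnum.symm ⟨v, h⟩))) else centre M,
    Or.inl rfl, ?_, ?_, ?_⟩
  · intro v hv
    refine ⟨?_, ?_⟩
    · dsimp only
      rw [dif_pos hv, centre]
      intro h
      have := (combIdx M).symm.injective h
      simp at this
    · dsimp only
      rw [dif_pos hv, comb_symm_apply, comb_centre]
      simp [combPos]
  · intro v hv w hw hvw
    rw [Finset.mem_coe] at hv hw
    have hvw' : (combIdx M).symm (Sum.inl (Sum.inr (patEnum.symm ⟨v, hv⟩))) =
        (combIdx M).symm (Sum.inl (Sum.inr (patEnum.symm ⟨w, hw⟩))) := by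
      simpa only [dif_pos hv, dif_pos hw] using hvw
    have h1 := (combIdx M).symm.injective hvw'
    simp only [Sum.inl.injEq, Sum.inr.injEq] at h1
    have h2 := patEnum.symm.injective h1
    simpa using congrArg Subtype.val h2
  · intro j hj hdist
    obtain ⟨u, rfl⟩ := (combIdx M).symm.surjective j
    rcases u with ((k | q) | o)
    · exfalso
      rw [comb_symm_apply, comb_centre, dist_zero_right] at hdist
      have h2 := two_le_norm_combFar M k
      change ‖combFar M k‖ ≤ 3 / 2 * 1 at hdist
      linarith
    · refine ⟨patEnum q, (patEnum q).2, ?_⟩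
      simp
    · exfalso
      apply hj
      rw [Subsingleton.elim o 0]
      rfl

/-- **The centre's site energy is `≤ −M/2000`**: the `18` pattern terms are `≤ 0`
(norms `1`, `√2`), the `M` far terms are `≤ −1/2000` each. -/
theorem siteEnergy_centre_le (M : ℕ) :
    siteEnergy lennardJones (comb M) (centre M) ≤ -((M : ℝ) / 2000) := by
  classical
  unfold siteEnergy
  have hsplit := Finset.sum_erase_eq_sub (f := fun k => lennardJones (dist (comb M (centre M)) (comb M k)))
    (Finset.mem_univ (centre M))
  rw [hsplit, dist_self]
  have hV0 : lennardJones 0 = 0 := by norm_num [lennardJones]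
  rw [hV0, sub_zero, comb_centre]
  rw [← Fintype.sum_equiv (combIdx M).symm (fun u => lennardJones (dist (0 : E3) (combPos M u)))
    (fun n => lennardJones (dist (0 : E3) (comb M n))) (fun u => by rw [comb_symm_apply])]
  rw [Fintype.sum_sum_type, Fintype.sum_sum_type]
  have hfar : ∑ k : Fin M, lennardJones (dist (0 : E3) (combPos M (Sum.inl (Sum.inl k)))) ≤
      ∑ _k : Fin M, (-(1 / 2000) : ℝ) := by
    refine Finset.sum_le_sum fun k _ => ?_
    show lennardJones (dist (0 : E3) (combFar M k)) ≤ -(1 / 2000)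
    rw [dist_comm, dist_zero_right]
    exact lennardJones_le_on_annulus (two_le_norm_combFar M k) (norm_combFar_le k)
  have hpat : ∑ q : Fin 18, lennardJones (dist (0 : E3) (combPos M (Sum.inl (Sum.inr q)))) ≤ 0 := by
    refine Finset.sum_nonpos fun q _ => ?_
    show lennardJones (dist (0 : E3) ((patEnum q : {v : E3 // v ∈ fccTwoShellPattern}) : E3)) ≤ 0
    rw [dist_comm, dist_zero_right]
    exact lennardJones_nonpos (one_le_norm_pat q)
  have hone : ∑ o : Fin 1, lennardJones (dist (0 : E3) (combPos M (Sum.inr o))) = 0 := by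
    rw [Fin.sum_univ_one]
    show lennardJones (dist (0 : E3) 0) = 0
    rw [dist_self, hV0]
  rw [Finset.sum_const, Finset.card_univ, Fintype.card_fin, nsmul_eq_mul] at hfar
  rw [hone]
  linarith

end Summit.AtomisticToContinuum.Crystallization.Theorems.NearFieldConvexity.Negative.Comb
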